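import Mathlib
import HarnessLib
import Summits.QuantumFields.YangMills.Theorems.PencilRigidityShellRigidityPlanarAngularRigidity

/-!
# Sketch — crux idea `dilaton-background-rigidity-tower` (crux stmt-QuantumFields-15892,
`CertificationLength.NPointIsotropyBelowThreshold`; crux-ideate round 1, ideator 2)

Two first lemmas of the line, stated over existing declarations (not proved here):

* `hasDerivAt_tilted_expectation` — the LATTICE FACE (Feynman–Hellmann = covariance): for a
  probability measure `μ` (Wilson's torus measure at step `k`), a bounded observable `f` (a product
  of smeared plaquette fields) and a bounded "source" `g` (the plaquette field smeared against a
  PLANE-CONSTANT transverse coupling profile `1 ⊗ w`), the expectation of `f` in the tilted measure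
  `e^{s g} dμ / Z(s)` is differentiable at `s = 0` with derivative `Cov_μ(f, g)`. Because the curvature
  species IS Wilson's action density, tilting by `s·g` is the Wilson theory with the position-dependent
  coupling `β_k + s·Z_k·w(a_k x_⊥)`, which keeps planar translations, the planar `D₄` and axis
  reflection positivity exactly.
* `tower_engine` — the MODEL-BLIND ENGINE: a one-parameter family of planar kernels each of which
  satisfies the hypotheses of the LANDED planar pencil engine
  `ShellRigidity.TransverseSmearingPlanarThreshold.stub_planarAngularRigidity` (order `σ < 8`,
  `D₄`, axis and diagonal Laplace–Fourier charts on the cone) has all its `s`-derivatives at `s = 0`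
  constant on circles — applied to the transversally smeared two-point kernels of the background
  theories, whose `n`-th `s`-derivatives are (by the lattice face and the tie) the connected
  `(2+n)`-point functions of `S₁` with `n` plane-smeared spectators: the TOWER.
-/

noncomputable section

open MeasureTheory Set Filter
open scoped Topology

namespace Summit.QuantumFields.YangMills.Cruxes.NPointIsotropyBelowThreshold.DilatonBackgroundRigidityTower

/-- **Lattice face (Feynman–Hellmann).** Tilting a probability measure by `e^{s g}` and
differentiating the normalised expectation of `f` at `s = 0` gives the covariance of `f` and `g`.
(Bounded `f`, `g`; dominated differentiation under the integral sign.) -/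
theorem hasDerivAt_tilted_expectation {Ω : Type*} [MeasurableSpace Ω] (μ : Measure Ω)
    [IsProbabilityMeasure μ] (f g : Ω → ℝ) (hf : Measurable f) (hg : Measurable g)
    (Cf Cg : ℝ) (hfb : ∀ ω, |f ω| ≤ Cf) (hgb : ∀ ω, |g ω| ≤ Cg) :
    HasDerivAt
      (fun s : ℝ => (∫ ω, f ω * Real.exp (s * g ω) ∂μ) / (∫ ω, Real.exp (s * g ω) ∂μ))
      ((∫ ω, f ω * g ω ∂μ) - (∫ ω, f ω ∂μ) * (∫ ω, g ω ∂μ)) 0 := by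
  sorry

/-- **Model-blind engine of the tower.** If every member `F s` (`|s| < s₀`) of a one-parameter
family of planar kernels satisfies the hypotheses of the landed planar pencil engine
(`stub_planarAngularRigidity`: continuous off `0`, order `σ < 8`, `D₄`-symmetric, axis and
diagonal Laplace–Fourier charts carried by the cone), then every `s`-derivative of the family at
`s = 0` is constant on circles. (Each member is radial by the landed stub; derivatives of a family
of radial functions are radial.) -/
theorem tower_engine (F : ℝ → ℝ × ℝ → ℝ) (s₀ σ : ℝ) (hs₀ : 0 < s₀) (hσ : 0 < σ) (hσ8 : σ < 8)
    (hc : ∀ s ∈ Ioo (-s₀) s₀, ContinuousOn (F s) {x | x ≠ 0})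
    (hb : ∀ s ∈ Ioo (-s₀) s₀, ∃ C : ℝ, ∀ x : ℝ × ℝ, x ≠ 0 →
      |F s x| ≤ C * (1 + (x.1 ^ 2 + x.2 ^ 2) ^ (-(σ / 2))))
    (hsym : ∀ s ∈ Ioo (-s₀) s₀, ∀ t u : ℝ,
      F s (t, u) = F s (u, t) ∧ F s (t, u) = F s (t, -u) ∧ F s (t, u) = F s (-t, u))
    (hA : ∀ s ∈ Ioo (-s₀) s₀, ∀ ε : ℝ, 0 < ε →
      ∃ μ : Measure (EuclideanSpace ℝ (Fin 4)), IsFiniteMeasure μ ∧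
        μ {p | p 0 < 0} = 0 ∧ μ {p | p 0 < |p 1|} = 0 ∧
        ∀ t : ℝ, 0 ≤ t → ∀ b : ℝ, ((F s (ε + t, b) : ℝ) : ℂ) =
          ∫ p, Complex.exp ((((-(t * p 0) : ℝ)) : ℂ) + ((b * p 1 : ℝ) : ℂ) * Complex.I) ∂μ)
    (hD : ∀ s ∈ Ioo (-s₀) s₀, ∀ ε : ℝ, 0 < ε →
      ∃ μ : Measure (EuclideanSpace ℝ (Fin 4)), IsFiniteMeasure μ ∧
        μ {p | p 0 < 0} = 0 ∧ μ {p | p 0 < |p 1|} = 0 ∧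
        ∀ u : ℝ, 0 ≤ u → ∀ v : ℝ,
          ((F s ((ε + u + v) / Real.sqrt 2, (ε + u - v) / Real.sqrt 2) : ℝ) : ℂ) =
            ∫ p, Complex.exp ((((-(u * p 0) : ℝ)) : ℂ) + ((v * p 1 : ℝ) : ℂ) * Complex.I) ∂μ) :
    ∀ (n : ℕ) (r φ : ℝ), 0 < r →
      iteratedDeriv n (fun s => F s (r * Real.cos φ, r * Real.sin φ)) 0 =
        iteratedDeriv n (fun s => F s (r, 0)) 0 := by
  intro n r φ hr
  -- each member is radial (landed planar pencil engine), on the whole neighbourhood of `0`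
  have hrad : ∀ s ∈ Ioo (-s₀) s₀, F s (r * Real.cos φ, r * Real.sin φ) = F s (r, 0) := fun s hs =>
    Summit.QuantumFields.YangMills.Cruxes.ShellRigidity.TransverseSmearingPlanarThreshold.stub_planarAngularRigidity
      (F s) σ hσ hσ8 (hc s hs) (hb s hs) (hsym s hs) (hA s hs) (hD s hs) r φ hr
  have hev : (fun s => F s (r * Real.cos φ, r * Real.sin φ)) =ᶠ[𝓝 0] fun s => F s (r, 0) := by
    filter_upwards [Ioo_mem_nhds (by linarith : -s₀ < 0) hs₀] with s hs
    exact hrad s hs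
  exact hev.iteratedDeriv_eq n

end Summit.QuantumFields.YangMills.Cruxes.NPointIsotropyBelowThreshold.DilatonBackgroundRigidityTower

end
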